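import Summits.BirchSwinnertonDyer.BirchSwinnertonDyer.Theorems.AdditiveKolyvaginRoadKummerDescentBaseField
import Summits.BirchSwinnertonDyer.Rank1Residual.Additive.KummerSelmerRestriction
import HarnessLib

/-!
# Route `AdditiveKolyvaginRoad`, crux `LevelKolyvaginSystemsAdditive` (item stmt-BirchSwinnertonDyer-21396, KS′):
# TRANSFER OF AN IDENTITY OF LOCAL KUMMER CONDITIONS FROM `F` TO `K` ALONG THE TORSION TRANSFER `θ = T_E ∘ e ∘ T_{E₀}⁻¹`
# — brick B2b of the K-half of stub `stub_kummerLineAtP` of line `epsilon_matched_retyping` (cell `pub/bsd-wall`, width seat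
# `bsd-wall-akr-p2x-w2` g4; `--supports stmt-BirchSwinnertonDyer-21396`, helper; namespace `…Theorems.AdditiveKoly.KummerDescent`)

WHY. Brick B2a (`…KummerDescentBaseField`, p607822) moves an identity `φ_{F,*} 𝓚_E(W₀) = 𝓚_E(W)` of local Kummer conditions at a
local field `E`, for curves `W, W₀` over `F` and an intertwining map `φ_F : W₀[n] → W[n]`, to the base-changed curves `W ⊗ K`,
`W₀ ⊗ K` over `K ⊇ F` and an intertwining map `φ_K` with `β_W ∘ φ_F = φ_K ∘ β_{W₀}`, where `β` is ANY change of coefficients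
matching the torsion comparisons. This file (i) identifies `β` with the tree's torsion transfer
`T_X = torsionTransferEquiv : X[n](F̄) ≃ (X ⊗ K)[n](K̄)` up to ONE element `γ ∈ Γ_F` independent of the curve (`β_X = T_X ∘ γ`:
the two `F`-embeddings `F̄ → Ē` — the chosen one, and `F̄ → K̄ → Ē` — differ by `γ`), (ii) concludes that for a
`Γ_F`-equivariant `e : W₀[n] ≃ W[n]` the transferred isomorphism **`θ := T_W ∘ e ∘ T_{W₀}⁻¹`** (the `θ` of w3's landed
`stub_torsionIsoBaseChange`, p602788) satisfies `β_W ∘ e = θ ∘ β_{W₀}`, hence carries the identity, and (iii) turns a local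
identity at a `K`-field `E` into the statement about GLOBAL classes `y ∈ H¹(K, W₀[n])` that the transfer socket consumes:
`θ_* y` satisfies the local Selmer condition of `W ⊗ K` at `E` iff `y` satisfies that of `W₀ ⊗ K`.

WHAT.
* §1 `congrEquiv_pointsCongr`, `congrEquiv_pointsMap_torsionTransferEquiv` (coordinates: `congr (ι_{K,E,*} (T_X Q)) = (ι_{K,E} ∘ ι_{F,K})_* Q`),
  **`exists_gal_forall_eq_torsionTransferEquiv_smul`** (`∃ γ ∈ Γ_F`, for every `X/F` and every `β` matching the torsion
  comparisons, `β P = T_X (γ • P)`).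
* §2 `torsionTransfer_conj_smul` (`θ = T_W ∘ e ∘ T_{W₀}⁻¹` is `Γ_K`-equivariant), **`map_kummerLocalConditionAt_baseChange_of_map_eq`**
  (`φ_{F,*} 𝓚_E(W₀) = 𝓚_E(W) ⟹ θ_* 𝓚_E(W₀ ⊗ K) = 𝓚_E(W ⊗ K)` at any field `E` with `[Algebra F E] [Algebra K E] [IsScalarTower F K E]`).
* §3 **`h1Equiv_mem_selmerLocalKer_iff_of_map_kummerLocalConditionAt_eq`** — for curves `W', W₀'` over `K`, a `Γ_K`-equivariant
  `θ : W₀'[n] ≃ W'[n]` and a `K`-field `E`: `θ_* 𝓚_E(W₀') = 𝓚_E(W')` ⟹ `∀ y, h1Equiv θ y ∈ selmerLocalKer W' E n ↔ y ∈ selmerLocalKer W₀' E n`.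

HONEST FRAMING: theorems only; 0 definitions, 0 named facts, 0 `sorry`; Galois bookkeeping. Closes nothing by itself (the sequel
instantiates `F = ℚ`, `E = ℚ_u` made a `K`-field at a split `v ∣ p`, and feeds w2 g3's ℚ-level identity p601209). BSD is not
proved by any of this.

References: [cite: SerreGaloisCohomology1997, I §2.4, II §1.1] [cite: SilvermanAEC2009, VIII.§1, X.§4] [cite: MilneADT2006, Ch. I §6].
-/

-- single-conjunct summit: `Summit.BirchSwinnertonDyer.BirchSwinnertonDyer.…` repeats the name by design
set_option linter.dupNamespace false
set_option autoImplicit false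

noncomputable section

open scoped Classical

universe u

namespace Summit.BirchSwinnertonDyer.BirchSwinnertonDyer.Theorems.AdditiveKoly.KummerDescent

open WeierstrassCurve Field
  Literature.NumberTheory.EllipticCurves Literature.NumberTheory.GaloisRepresentations
open scoped ContRepresentation

/-! ## §1 `β = T ∘ γ` for one `γ ∈ Γ_F` -/

section Gamma

variable {F K : Type u} [Field F] [Field K] [Algebra F K]
  (E : Type u) [Field E] [Algebra F E] [Algebra K E] [IsScalarTower F K E]
  (X : WeierstrassCurve F)

/-- `congr ∘ pointsCongr = id` on the points over `Ē` (both are the identity on coordinates). [folklore] -/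
theorem congrEquiv_pointsCongr (h : (X.baseChange K).baseChange (AlgebraicClosure E) = X.baseChange (AlgebraicClosure E))
    (R : (X.baseChange (AlgebraicClosure E)).toAffine.Point) :
    Affine.Point.congrEquiv h (pointsCongr X K (AlgebraicClosure E) R) = R := by
  rcases R with _ | ⟨x, y, hxy⟩
  · change Affine.Point.congrEquiv h (pointsCongr X K (AlgebraicClosure E) 0) = 0
    rw [map_zero, map_zero]
  · simp only [pointsCongr, Affine.Point.congrEquiv_some]

variable [CharZero F] [X.IsElliptic] {n : ℤ} (hn : n ≠ 0)

/-- **Coordinates of the torsion transfer read at `E`**: for `Q ∈ X[n](F̄)`, the image in `X(Ē)` of the point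
`T_X Q ∈ (X ⊗ K)[n](K̄)` under the chosen `K̄ → Ē` is the image of `Q` under the composite `F̄ → K̄ → Ē` of the chosen embeddings.
[cite: SilvermanAEC2009, VIII.§1] -/
theorem congrEquiv_pointsMap_torsionTransferEquiv
    (h : (X.baseChange K).baseChange (AlgebraicClosure E) = X.baseChange (AlgebraicClosure E)) (Q : geomTorsion X n) :
    (show localPoints (X.baseChange K) E ≃+ localPoints X E from Affine.Point.congrEquiv h)
        (pointsMap (X.baseChange K) E ((X.torsionTransferEquiv (E := K) hn Q : geomTorsion (X.baseChange K) n) :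
          geomPoints (X.baseChange K))) =
      pointsMapOfEmb X (((closureEmb (K := K) E).restrictScalars F).comp (closureEmb (K := F) K)) (Q : geomPoints X) := by
  rw [coe_torsionTransferEquiv_apply, baseChangeGeomPointsEquiv_symm_apply]
  change Affine.Point.congrEquiv h (Affine.Point.map (closureEmb (K := K) E)
      (pointsCongr X K (AlgebraicClosure K) (Affine.Point.map (closureEmb (K := F) K) (Q : geomPoints X)))) =
    Affine.Point.map (((closureEmb (K := K) E).restrictScalars F).comp (closureEmb (K := F) K)) (Q : geomPoints X)
  rw [← pointsCongr_map X K (closureEmb (K := K) E), Affine.Point.map_map, congrEquiv_pointsCongr]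

/-- **`β = T ∘ γ` for ONE `γ ∈ Γ_F`.** The chosen `F`-embedding `F̄ → Ē` and the composite `F̄ → K̄ → Ē` of the chosen
embeddings differ by an automorphism `γ` of `F̄/F` (`exists_algHom_eq_comp`); consequently, for EVERY elliptic `X/F` and every
change of coefficients `β : X[n](F̄) ≃ (X ⊗ K)[n](K̄)` matching the torsion comparisons at `E`, `β P = T_X (γ • P)` with the tree's
torsion transfer `T_X = torsionTransferEquiv` (along `F̄ → K̄`). [cite: SerreGaloisCohomology1997, II §1.1] [cite: SilvermanAEC2009, VIII.§1] -/
theorem exists_gal_forall_eq_torsionTransferEquiv_smul :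
    ∃ γ : absoluteGaloisGroup F, ∀ (X : WeierstrassCurve F) [X.IsElliptic] [(X.baseChange K).IsElliptic]
      (h : (X.baseChange K).baseChange (AlgebraicClosure E) = X.baseChange (AlgebraicClosure E))
      (β : geomTorsion X n ≃+ geomTorsion (X.baseChange K) n)
      (_hβ : ∀ P : geomTorsion X n,
        (show localPoints (X.baseChange K) E ≃+ localPoints X E from Affine.Point.congrEquiv h)
            (pointsMap (X.baseChange K) E (β P : geomTorsion (X.baseChange K) n)) = pointsMap X E (P : geomPoints X))
      (P : geomTorsion X n), β P = X.torsionTransferEquiv (E := K) hn (γ • P) := by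
  obtain ⟨γ, hγ⟩ := exists_algHom_eq_comp
    (((closureEmb (K := K) E).restrictScalars F).comp (closureEmb (K := F) K)) (closureEmb (K := F) E)
  refine ⟨γ, fun X _ _ h β hβ P ↦ ?_⟩
  apply Subtype.ext
  apply pointsMapOfEmb_injective (X.baseChange K) (closureEmb (K := K) E)
  apply (show localPoints (X.baseChange K) E ≃+ localPoints X E from Affine.Point.congrEquiv h).injective
  change (show localPoints (X.baseChange K) E ≃+ localPoints X E from Affine.Point.congrEquiv h)
      (pointsMap (X.baseChange K) E (β P : geomTorsion (X.baseChange K) n)) =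
    (show localPoints (X.baseChange K) E ≃+ localPoints X E from Affine.Point.congrEquiv h)
      (pointsMap (X.baseChange K) E ((X.torsionTransferEquiv (E := K) hn ((show absoluteGaloisGroup F from γ) • P) :
        geomTorsion (X.baseChange K) n) : geomPoints (X.baseChange K)))
  rw [hβ, congrEquiv_pointsMap_torsionTransferEquiv E X hn h]
  change pointsMapOfEmb X (closureEmb (K := F) E) (P : geomPoints X) =
    pointsMapOfEmb X (((closureEmb (K := K) E).restrictScalars F).comp (closureEmb (K := F) K))
      ((((show absoluteGaloisGroup F from γ) • P : geomTorsion X n) : geomPoints X))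
  rw [hγ, pointsMapOfEmb_comp]
  rfl

end Gamma

/-! ## §2 The transferred isomorphism `θ = T_W ∘ e ∘ T_{W₀}⁻¹` carries the identity -/

section Theta

variable {F K : Type u} [Field F] [Field K] [Algebra F K] [CharZero F] [CharZero K]
  (W W₀ : WeierstrassCurve F) [W.IsElliptic] [W₀.IsElliptic] [(W.baseChange K).IsElliptic] [(W₀.baseChange K).IsElliptic]
  {n : ℤ} (hn : n ≠ 0)
  (e : geomTorsion W₀ n ≃+ geomTorsion W n)
  (he : ∀ (σ : absoluteGaloisGroup F) (P : geomTorsion W₀ n), e (σ • P) = σ • e P)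

omit [CharZero K] [(W.baseChange K).IsElliptic] [(W₀.baseChange K).IsElliptic] in
include he in
/-- **`θ = T_W ∘ e ∘ T_{W₀}⁻¹` is `Γ_K`-equivariant** (`Γ_K` acting on `X[n](F̄)` through `Γ_K → Γ_F`, along which both torsion
transfers are equivariant). [cite: SerreGaloisCohomology1997, I §2.4] -/
theorem torsionTransfer_conj_smul (g : absoluteGaloisGroup K) (R : geomTorsion (W₀.baseChange K) n) :
    W.torsionTransferEquiv (E := K) hn (e ((W₀.torsionTransferEquiv (E := K) hn).symm (g • R))) =
      g • W.torsionTransferEquiv (E := K) hn (e ((W₀.torsionTransferEquiv (E := K) hn).symm R)) := by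
  rw [torsionTransferEquiv_symm_smul, he, torsionTransferEquiv_smul]

variable (E : Type u) [Field E] [Algebra F E] [Algebra K E] [IsScalarTower F K E]

include he in
/-- **THE TRANSFER.** For a `Γ_F`-equivariant `e : W₀[n] ≃ W[n]`, intertwining maps `φ_F` (= `e` on points) over `F` and `φ_K`
(= `θ := T_W ∘ e ∘ T_{W₀}⁻¹` on points) over `K`, and any field `E` over the tower `F ⊆ K`: if `φ_{F,*} 𝓚_E(W₀) = 𝓚_E(W)` in
`H¹(Γ_E, W[n](F̄))` then `φ_{K,*} 𝓚_E(W₀ ⊗ K) = 𝓚_E(W ⊗ K)` in `H¹(Γ_E, (W ⊗ K)[n](K̄))` — brick B2a with `β = T ∘ γ` (§1) and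
`T_W γ e = T_W e γ` (`e` is `Γ_F`-equivariant). [cite: SerreGaloisCohomology1997, I §2.4] [cite: SilvermanAEC2009, X.§4] -/
theorem map_kummerLocalConditionAt_baseChange_of_map_eq
    (φF : (W₀.torsionGaloisModule n).toContRepresentation →ⁱL (W.torsionGaloisModule n).toContRepresentation)
    (hφF : ∀ a, φF a = e a)
    (φK : ((W₀.baseChange K).torsionGaloisModule n).toContRepresentation →ⁱL
      ((W.baseChange K).torsionGaloisModule n).toContRepresentation)
    (hφK : ∀ b, φK b = W.torsionTransferEquiv (E := K) hn (e ((W₀.torsionTransferEquiv (E := K) hn).symm b)))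
    (hF : (W₀.kummerLocalConditionAt n E).map (galoisCohomology.map (φF.restrictField E) 1) = W.kummerLocalConditionAt n E) :
    ((W₀.baseChange K).kummerLocalConditionAt n E).map (galoisCohomology.map (φK.restrictField E) 1) =
      (W.baseChange K).kummerLocalConditionAt n E := by
  have h := baseChange_baseChange_algebraicClosure_eq (F := F) (K := K) E W
  have h₀ := baseChange_baseChange_algebraicClosure_eq (F := F) (K := K) E W₀
  obtain ⟨βW, hβW⟩ := exists_addEquiv_pointsMap_eq (F := F) (K := K) E W (n := n) h hn
  obtain ⟨βW₀, hβW₀⟩ := exists_addEquiv_pointsMap_eq (F := F) (K := K) E W₀ (n := n) h₀ hn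
  obtain ⟨γ, hγ⟩ := exists_gal_forall_eq_torsionTransferEquiv_smul (F := F) (K := K) E hn
  refine map_kummerLocalConditionAt_transport E W W₀ n h h₀ βW hβW βW₀ hβW₀ φF φK (fun P ↦ ?_) hF
  rw [hφF, hφK, hγ W h βW hβW, hγ W₀ h₀ βW₀ hβW₀, AddEquiv.symm_apply_apply, he]

end Theta

/-! ## §3 From the local identity at a `K`-field to the statement about global classes -/

section Global

variable {K : Type u} [Field K] (W' W₀' : WeierstrassCurve K) (n : ℤ)
  (θ : geomTorsion W₀' n ≃+ geomTorsion W' n)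
  (hθ : ∀ (g : absoluteGaloisGroup K) (P : geomTorsion W₀' n), θ (g • P) = g • θ P)
  (E : Type u) [Field E] [Algebra K E]

/-- **Global classes: `θ_* y` satisfies the local Selmer condition of `W'` at `E` iff `y` satisfies that of `W₀'`**, as soon as
`θ_* 𝓚_E(W₀') = 𝓚_E(W')` (for any intertwining map `φ` equal to `θ` on points): the Selmer local kernel is the preimage of the
local Kummer condition under restriction (`comap_res_kummerLocalConditionAt`), restriction commutes with `θ_*`
(`galoisCohomology.res_map_one`), `H¹(φ) = h1Equiv θ`, and `φ_*` is injective at `E` (left inverse `θ⁻¹`).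
[cite: SerreGaloisCohomology1997, I §2.4] [cite: SilvermanAEC2009, X.§4] -/
theorem h1Equiv_mem_selmerLocalKer_iff_of_map_kummerLocalConditionAt_eq
    (φ : (W₀'.torsionGaloisModule n).toContRepresentation →ⁱL (W'.torsionGaloisModule n).toContRepresentation)
    (hφ : ∀ b, φ b = θ b)
    (hloc : (W₀'.kummerLocalConditionAt n E).map (galoisCohomology.map (φ.restrictField E) 1) = W'.kummerLocalConditionAt n E)
    (y : galH1Torsion W₀' n) :
    h1Equiv θ hθ y ∈ selmerLocalKer W' E n ↔ y ∈ selmerLocalKer W₀' E n := by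
  obtain ⟨φ', ψ', hφ', -, hψφ', -, hmap⟩ := exists_intertwining_of_addEquiv W' W₀' n θ hθ
  have hφφ' : ∀ b, φ b = φ' b := fun b ↦ by rw [hφ, hφ']
  have hmapφ : galoisCohomology.map φ 1 y = h1Equiv θ hθ y := by rw [map_congr_apply φ φ' hφφ', hmap]
  have hinj : Function.Injective (galoisCohomology.map (φ.restrictField E) 1) := by
    intro a b hab
    rw [map_congr_apply (φ.restrictField E) (φ'.restrictField E) (fun x ↦ hφφ' x) a,
      map_congr_apply (φ.restrictField E) (φ'.restrictField E) (fun x ↦ hφφ' x) b] at hab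
    exact Summit.BirchSwinnertonDyer.Rank1Residual.X11b.Levels.map_injective_of_comp_eq
      (φ'.restrictField E) (ψ'.restrictField E) hψφ' hab
  rw [← comap_res_kummerLocalConditionAt, ← comap_res_kummerLocalConditionAt]
  change galoisCohomology.res (W'.torsionGaloisModule n) E 1 (h1Equiv θ hθ y) ∈ W'.kummerLocalConditionAt n E ↔
    galoisCohomology.res (W₀'.torsionGaloisModule n) E 1 y ∈ W₀'.kummerLocalConditionAt n E
  rw [← hmapφ, galoisCohomology.res_map_one, ← hloc]
  constructor
  · rintro ⟨z, hz, hzy⟩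
    rwa [← hinj hzy]
  · exact fun hy ↦ AddSubgroup.mem_map_of_mem _ hy

end Global

end Summit.BirchSwinnertonDyer.BirchSwinnertonDyer.Theorems.AdditiveKoly.KummerDescent

end
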